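import Summits.HodgeConjecture.HodgeCM.Prior.Perl34_3

/-! PORT of `HodgeCM/Prior/Perl34.lean` (HodgeCMPerL run 81) — part 4: continuation of `Summits.HodgeConjecture.HodgeCM.Prior.Perl34_3` (split at a top-level declaration boundary by port_pkg.py; scope re-opened below; declarations unchanged). -/

-- port_pkg: scope re-opened for this part (file-level context, then the namespace/section stack open at the cut)
namespace HodgeCM.Prior.Perl34File
namespace Perl34
namespace C4
open Complex
/-- |log(eulerFactor t a)| ≤ 4t for 0 ≤ t ≤ 1/2 — the comparison that turns the A#11
summability Σ t_v < ∞ into summability of the log series (t_v = q_v^{−3/2} ≤ 2^{−3/2}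
< 1/2 at every finite place). -/
theorem abs_log_eulerFactor_le {t : ℝ} (ht0 : 0 ≤ t) (ht : t ≤ 1 / 2) {a : ℂ}
    (ha : ‖a‖ = 1) : |Real.log (eulerFactor t a)| ≤ 4 * t := by
  have ht1 : t < 1 := by linarith
  have h1t : (0 : ℝ) < 1 - t := by linarith
  have h1t' : (0 : ℝ) < 1 + t := by linarith
  have hef : 0 < eulerFactor t a := eulerFactor_pos ht0 ht1 ha
  have hat : ‖a * (t : ℂ)‖ = t := norm_mul_ofReal ha ht0
  have hlo : 1 - t ≤ ‖(1 : ℂ) - a * t‖ := by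
    have h₁ := norm_sub_norm_le (1 : ℂ) (a * t)
    rw [norm_one, hat] at h₁
    exact h₁
  have hhi : ‖(1 : ℂ) - a * t‖ ≤ 1 + t := by
    have h₁ := norm_sub_le (1 : ℂ) (a * t)
    rw [norm_one, hat] at h₁
    exact h₁
  have hnq : Complex.normSq ((1 : ℂ) - a * t) = ‖(1 : ℂ) - a * t‖ ^ 2 :=
    Complex.normSq_eq_norm_sq _
  have hsq_lo : (1 - t) ^ 2 ≤ Complex.normSq ((1 : ℂ) - a * t) := by
    rw [hnq]; exact pow_le_pow_left₀ h1t.le hlo 2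
  have hsq_hi : Complex.normSq ((1 : ℂ) - a * t) ≤ (1 + t) ^ 2 := by
    rw [hnq]; exact pow_le_pow_left₀ (norm_nonneg _) hhi 2
  have hnq_pos : 0 < Complex.normSq ((1 : ℂ) - a * t) :=
    Complex.normSq_pos.mpr (one_sub_mul_ne_zero ht0 ht1 ha)
  have hef_hi : eulerFactor t a ≤ (1 + t) / (1 - t) := by
    rw [eulerFactor, div_le_div_iff₀ hnq_pos h1t]
    nlinarith [mul_le_mul_of_nonneg_left hsq_lo h1t'.le]
  have hef_lo : (1 - t) / (1 + t) ≤ eulerFactor t a := by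
    rw [eulerFactor, div_le_div_iff₀ h1t' hnq_pos]
    nlinarith [mul_le_mul_of_nonneg_left hsq_hi h1t.le]
  have hstep : (1 + t) / (1 - t) - 1 ≤ 4 * t := by
    rw [div_sub_one h1t.ne', div_le_iff₀ h1t]
    nlinarith
  have hlog_hi : Real.log (eulerFactor t a) ≤ 4 * t := by
    have h₁ := Real.log_le_sub_one_of_pos hef
    linarith [hef_hi]
  have hinv_hi : (eulerFactor t a)⁻¹ ≤ (1 + t) / (1 - t) := by
    have h₀ : 0 < (1 - t) / (1 + t) := div_pos h1t h1t'
    have h₁ := one_div_le_one_div_of_le h₀ hef_lo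
    rw [one_div, one_div, inv_div] at h₁
    exact h₁
  have hlog_lo : -(4 * t) ≤ Real.log (eulerFactor t a) := by
    have h₁ := Real.log_le_sub_one_of_pos (inv_pos.mpr hef)
    rw [Real.log_inv] at h₁
    linarith [hinv_hi]
  rw [abs_le]
  exact ⟨by linarith, by linarith⟩

/-- Comparison summability: |g| ≤ 4t pointwise and Σt < ∞ give Σg summable. -/
theorem summable_of_abs_le_mul {ι : Type} {g t : ι → ℝ} (hsum : Summable t)
    (h : ∀ i, |g i| ≤ 4 * t i) : Summable g :=
  Summable.of_abs
    (Summable.of_nonneg_of_le (fun _ => abs_nonneg _) h (hsum.mul_left 4))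

/-! ## The Rallis datum: lem:chars(b)'s inner-product chain as an interface -/

/-- **One Rallis datum** — the inner-product chain of lem:chars(b) (ll. 548–632) for
ONE candidate datum (W_i, μ_i, χ′_i) and ONE chosen factorizable Fock–Schwartz
vector φ = ⊗φ_v, at the plan's abstraction.  `V` indexes the finite places of L₀
together with the archimedean ones (the local factors of l. 609).  Fields carry
AX7 (+ the χ′-unconjugated orientation pin), the A#11 named summability, and the
A4/AX6-discharged ramified positivity; everything else is proved. -/
structure RallisDatum (V : Type) where
  /-- the local factors I_v(φ_v) = ∫⟨ω_v(y)φ_v, φ_v⟩ χ′_v(y) dy of the chosen φ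
  (l. 609; real by positive-definiteness, l. 612). -/
  Iloc : V → ℝ
  /-- the finite exceptional set S of l. 623–629 ("Enlarging S, for v ∉ S also
  φ_v = φ⁰_v and all splitting data are unramified"), including the archimedean
  places and the non-split ramified ones. -/
  S : Finset V
  /-- t v = q_v^{−3/2} (residue field size q_v ≥ 2; meaningful at split v ∉ S). -/
  tpar : V → ℝ
  /-- a_v = χ′_v(ϖ_v)ν_v(ϖ_v), |a_v| = 1 (l. 630–631). -/
  apar : V → ℂ
  /-- "v splits in L" (l. 610, 617, 629). -/
  IsSplit : V → Prop
  /-- the positive constant of Weil's Siegel–Weil formula (ll. 580–581, c > 0). -/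
  c : ℝ
  c_pos : 0 < c
  /-- ⟨θ_φ(χ′), θ_φ(χ′)⟩ — real (it is a squared L²-norm). -/
  innerSelf : ℝ
  /-- the value of the unramified tail product Π_{v∉S} I_v(φ⁰_v) (l. 631). -/
  tail : ℝ
  /-- AX7 ([PerL] ll. 548–631; GQT §11.3, Li92 (11)–(15),(26)–(27), Weil 1965; the
  χ′-UNCONJUGATED orientation pin of (eq:basic)/Li92 (26)): the Rallis inner-product
  factorization ⟨θ_φ(χ′),θ_φ(χ′)⟩ = c·Π_v I_v(φ_v) for the chosen φ, split as the
  finite ramified product times the tail. -/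
  AX7_factor : innerSelf = c * (∏ v ∈ S, Iloc v) * tail
  /-- AX7: the unramified tail converges (multipliably) to `tail` (l. 631 "converges
  absolutely"). -/
  AX7_tail : HasProd (fun v : {w : V // w ∉ S} => Iloc v.1) tail
  /-- 0 ≤ t_v. -/
  tpar_nonneg : ∀ v : V, 0 ≤ tpar v
  /-- t_v = q_v^{−3/2} ≤ 2^{−3/2} < 1/2 (q_v ≥ 2). -/
  tpar_le : ∀ v : V, tpar v ≤ 1 / 2
  /-- |a_v| = 1 (χ′ and ν unitary, l. 630–631). -/
  apar_norm : ∀ v : V, ‖apar v‖ = 1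
  /-- A#11 NAMED INPUT (plan A5): Σ_{v∉S} q_v^{−3/2} < ∞ — A-provable by comparison
  with [L₀:ℚ]·Σ_p p^{−3/2} (Dedekind ζ at 3/2); carried as a field per the plan. -/
  A11_summable : Summable fun v : {w : V // w ∉ S} => tpar v.1
  /-- l. 629–631: at split v ∉ S the local factor is the unramified series
  Σ_{n∈ℤ} q_v^{−3|n|/2} a_vⁿ (the integral evaluated on the spherical vector; the
  closed form is PROVED above, plan A5). -/
  AX7_split_val : ∀ v : V, v ∉ S → IsSplit v →
    (Iloc v : ℂ) = ∑' n : ℤ, (tpar v : ℂ) ^ n.natAbs * apar v ^ n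
  /-- l. 629: at non-split v ∉ S, I_v(φ⁰_v) = 1 (χ′_v trivial on the full compact
  group there, ll. 623–629). -/
  AX7_nonsplit_val : ∀ v : V, v ∉ S → ¬IsSplit v → Iloc v = 1
  /-- COMPOSITE (disclosed design cut; per-place discharges): at v ∈ S the chosen φ_v
  has I_v(φ_v) > 0 — at archimedean and non-split finite v by A4's projection formula
  I_v = vol·‖φ_v[χ̄′_v]‖² (S2's `A4_positivity_named`, [A#2] orientation) with the
  named nonzero χ̄′_v-isotypic vector (lem:arch(a) at real b; AX6/SZ conservation ⇒
  occurrence at non-split finite v, ll. 543–547, 613–617); at split v ∈ S by the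
  ball computation I_v = vol(D)·vol(U₁) > 0 (ll. 617–623; plan A10's set identity). -/
  ram_pos : ∀ v ∈ S, 0 < Iloc v

namespace RallisDatum

variable {V : Type} (D : RallisDatum V)

/-- Split tail factors are the Euler values (A5 consumed against the AX7 field). -/
theorem tail_factor_eq (v : V) (hv : v ∉ D.S) (hs : D.IsSplit v) :
    D.Iloc v = eulerFactor (D.tpar v) (D.apar v) :=
  eq_eulerFactor_of_ofReal_eq_tsum (D.tpar_nonneg v)
    (by linarith [D.tpar_le v]) (D.apar_norm v) (D.AX7_split_val v hv hs)

/-- Every unramified tail factor is positive (l. 629–631). -/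
theorem tail_factor_pos (v : V) (hv : v ∉ D.S) : 0 < D.Iloc v := by
  by_cases hs : D.IsSplit v
  · rw [D.tail_factor_eq v hv hs]
    exact eulerFactor_pos (D.tpar_nonneg v) (by linarith [D.tpar_le v]) (D.apar_norm v)
  · rw [D.AX7_nonsplit_val v hv hs]
    norm_num

/-- |log I_v| ≤ 4 t_v on the tail (split: the Euler bound; non-split: log 1 = 0). -/
theorem tail_abs_log_le (v : {w : V // w ∉ D.S}) :
    |Real.log (D.Iloc v.1)| ≤ 4 * D.tpar v.1 := by
  by_cases hs : D.IsSplit v.1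
  · rw [D.tail_factor_eq v.1 v.2 hs]
    exact abs_log_eulerFactor_le (D.tpar_nonneg v.1) (D.tpar_le v.1) (D.apar_norm v.1)
  · rw [D.AX7_nonsplit_val v.1 v.2 hs, Real.log_one, abs_zero]
    have := D.tpar_nonneg v.1
    linarith

/-- The log series of the tail is summable (A#11 + the Euler bound). -/
theorem tail_log_summable :
    Summable fun v : {w : V // w ∉ D.S} => Real.log (D.Iloc v.1) :=
  summable_of_abs_le_mul D.A11_summable D.tail_abs_log_le

/-- **The tail is positive** (l. 631 "converges absolutely to a positive number"). -/
theorem tail_pos : 0 < D.tail :=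
  pos_of_hasProd_of_summable_log (f := fun v : {w : V // w ∉ D.S} => D.Iloc v.1)
    (fun v => D.tail_factor_pos v.1 v.2) D.tail_log_summable D.AX7_tail

/-- **lem:chars(b), positivity** (l. 631–632): ⟨θ_φ(χ′), θ_φ(χ′)⟩ > 0. -/
theorem innerSelf_pos : 0 < D.innerSelf := by
  rw [D.AX7_factor]
  exact mul_pos (mul_pos D.c_pos (Finset.prod_pos fun v hv => D.ram_pos v hv)) D.tail_pos

end RallisDatum

/-! ## The H_chars discharge (lem:chars(b) → the frozen hypothesis, ll. 398–400) -/

/-- **Per-side H_chars discharge package** for a frozen `TorusData`: for every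
character χ ∈ X (type-w characters of [T]), a Rallis datum whose inner value is the
squared norm of the theta vector θ_{φ(χ)}(χ), and the semantic bridge to the bare
`allowed` predicate.  The bridge field `allowed_of_theta` carries the residual
Def 3.2 content (disclosed composite): θ ≠ 0 makes the theta space π ≠ 0, and the
constituents lie in 𝒜^{1,0} by AX3 (generators of archimedean type J⁺⊗1, the
lem:arch(a)-isotypic φ_b) + AX1b(d) (generated-by ⇒ all constituents, ll. 632–635;
plan A#6); the `w` of this package is the `w` of `D.Pw`/`D.wOccurs` (x1 coherence
pin — one w per side, [PerL] l. 398 resp. l. 402). -/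
structure CharsDischarge {H HG CG G SK SigIdx SigIdxG : Type*}
    [NormedAddCommGroup H] [InnerProductSpace ℂ H] [CompleteSpace H]
    [NormedAddCommGroup HG] [InnerProductSpace ℂ HG] [CompleteSpace HG]
    [NormedAddCommGroup CG] [NormedSpace ℂ CG]
    [Group G] [TopologicalSpace G] [TopologicalSpace SK]
    {C : IsolationCore H HG CG G SK SigIdx SigIdxG} (D : TorusData C) (V : Type) where
  /-- the Rallis chain for (one line datum of) the pair behind χ. -/
  rallis : D.X → RallisDatum V
  /-- the theta vector θ_φ(χ′) ∈ L²([G_U]) whose inner product AX7 computes. -/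
  θvec : D.X → HG
  /-- AX7's left side: the datum's inner value is ‖θ‖² (l. 597, 631–632). -/
  innerSelf_eq : ∀ χ, (rallis χ).innerSelf = ‖θvec χ‖ ^ 2
  /-- BRIDGE (semantic, D1 + AX3 + AX1b(d), disclosed composite): a nonzero theta
  vector for χ makes χ arise from an allowed pair — Def 3.2's two clauses for the
  constructed data (ll. 632–635 with l. 269–279). -/
  allowed_of_theta : ∀ χ : D.X, θvec χ ≠ 0 → D.allowed χ

namespace CharsDischarge

variable {H HG CG G SK SigIdx SigIdxG : Type*}
variable [NormedAddCommGroup H] [InnerProductSpace ℂ H] [CompleteSpace H]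
variable [NormedAddCommGroup HG] [InnerProductSpace ℂ HG] [CompleteSpace HG]
variable [NormedAddCommGroup CG] [NormedSpace ℂ CG]
variable [Group G] [TopologicalSpace G] [TopologicalSpace SK]
variable {C : IsolationCore H HG CG G SK SigIdx SigIdxG} {D : TorusData C} {V : Type}

/-- **lem:chars(b), nonvanishing** (l. 631–632): θ_φ(χ′) ≠ 0 — hence π_i ≠ 0. -/
theorem θvec_ne_zero (P : CharsDischarge D V) (χ : D.X) : P.θvec χ ≠ 0 := by
  intro h0
  have h := P.innerSelf_eq χ
  rw [h0, norm_zero] at h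
  have hpos := (P.rallis χ).innerSelf_pos
  rw [h] at hpos
  norm_num at hpos

/-- **The H_chars discharge** ([PerL] ll. 398–400, 441–442): every character of [T]
with χ_∞ = w arises from an allowed pair — the hypothesis shape consumed verbatim by
the frozen `IsolationSetting.H_chars12/34`. -/
theorem H_chars (P : CharsDischarge D V) : ∀ χ : D.X, D.allowed χ := fun χ =>
  P.allowed_of_theta χ (P.θvec_ne_zero χ)

end CharsDischarge

end C4
end Perl34
/-! # C4a = Lemma 4.1(c) (lem:arch(c), [PerL] v5 ll. 488–523) — the H_occ discharge

S4 tranche, third target (plan v2 @e3be098b C4a row, amendment A#9; the deferred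
A#8(iii) point-evaluation half, x1 cross-read item M1).  Byte-identical prefix =
C4_Chars.lean (`cmp`-verified in S4/README.md).

ADDED-HYPOTHESIS DISCIPLINE (task M1–M4): the frozen `IsolationSetting` @2def0917 is
NOT edited; the structure it lacks (the points of [G_U] behind C([G_U]), and the
per-place meaning of the bare `wOccurs`) is added HERE as separate structures
`PointedCore` / `OccDischarge`, every added field flagged `ADDED HYPOTHESIS (M1)` and
listed in S4/FIELDS-DELTA.md for the next x1 cross-read.

PROVED here: the deferred A#8(iii) half — v ↦ 𝒯_Φ(v)(g) is a continuous linear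
functional, DERIVED as `pointFunctional` (composition of the frozen sup-norm-bounded
`TΦc` with the added point evaluation), never a field; the L²-to-point nonvanishing
conversion; the tier-A Witt sign-to-sign lemma of A#9(ii); the P_w-fixed-vector
extraction; the discharge `H_occ` in the shape the frozen setting consumes; and the
capstone `mkIsolationSetting` assembling a full `IsolationSetting` from the C4/C4a
packages. -/

namespace Perl34
namespace C4a

variable {H HG CG G SK SigIdx SigIdxG : Type*}
variable [NormedAddCommGroup H] [InnerProductSpace ℂ H] [CompleteSpace H]
variable [NormedAddCommGroup HG] [InnerProductSpace ℂ HG] [CompleteSpace HG]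
variable [NormedAddCommGroup CG] [NormedSpace ℂ CG]
variable [Group G] [TopologicalSpace G] [TopologicalSpace SK]

/-- **The M1 point extension** of the frozen core (never an edit of the freeze): the
points of [G_U] behind C([G_U]), with sup-norm-bounded evaluation.  This is exactly
what the x1 cross-read (MISSING item M1) says C4a needs and Prop 3.6/Thm 3.7 do not:
"an evaluation CG → (pt → ℂ) bounded by the sup norm, to state l(v) := 𝒯_Φ(v)(g)
and 'nonzero for some g'" ([PerL] ll. 343–346, 513–522). -/
structure PointedCore (C : IsolationCore H HG CG G SK SigIdx SigIdxG) where
  /-- ADDED HYPOTHESIS (M1): the points g of the compact quotient [G_U]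
  ([PerL] l. 244, 514 "for some g"). -/
  Pt : Type
  /-- ADDED HYPOTHESIS (M1): evaluation of C([G_U]) at a point, bounded for the sup
  norm ([PerL] ll. 343–346; each eval is a norm-≤-1 functional on C([G_U])). -/
  evalPt : Pt → (CG →L[ℂ] ℂ)
  /-- ADDED HYPOTHESIS (M1): points separate C([G_U]) — a continuous function
  vanishing at every point of [G_U] is zero (the semantic content of `CG` being a
  FUNCTION space on [G_U]; [PerL] l. 514 "non-zero ... for some g"). -/
  evalPt_sep : ∀ φ : CG, (∀ p, evalPt p φ = 0) → φ = 0

variable (C : IsolationCore H HG CG G SK SigIdx SigIdxG)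

/-- **The deferred A#8(iii) half, DERIVED** ([PerL] ll. 518–520, L4.1(c): "it is
continuous for the L²-norm (𝒯_Φ is Hilbert–Schmidt and its image consists of
continuous functions depending continuously on v in the uniform norm)"): the linear
functional l(v) = 𝒯_Φ(v)(g), as the composition of the frozen sup-norm-bounded
`TΦc` with the added point evaluation — a bounded operator by construction, NOT a
field. -/
noncomputable def pointFunctional (P : PointedCore C) (Φ : SK) (p : P.Pt) :
    H →L[ℂ] ℂ :=
  (P.evalPt p).comp (C.TΦc Φ)

/-- The A#8(iii) continuity statement in the print's form: v ↦ 𝒯_Φ(v)(g) is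
continuous. -/
theorem pointFunctional_continuous (P : PointedCore C) (Φ : SK) (p : P.Pt) :
    Continuous fun v : H => P.evalPt p (C.TΦc Φ v) :=
  (pointFunctional C P Φ p).continuous

/-- L²-nonvanishing passes to the sup-norm level: 𝒯_Φ v ≠ 0 in L²([G_U]) forces
𝒯_Φ v ≠ 0 in C([G_U]) (the frozen composite `TΦ = inclCG ∘ TΦc`). -/
theorem TΦc_ne_zero {Φ : SK} {v : H} (h : C.TΦ Φ v ≠ 0) : C.TΦc Φ v ≠ 0 := by
  intro hc
  apply h
  show C.inclCG (C.TΦc Φ v) = 0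
  rw [hc, map_zero]

/-- Points detect sup-norm nonvanishing ([PerL] l. 513–514 "non-zero on 𝒮^κ × σ̂ for
some g"): if 𝒯_Φ v ≠ 0 in C([G_U]) then some point evaluation is nonzero. -/
theorem exists_evalPt_ne_zero (P : PointedCore C) {Φ : SK} {v : H}
    (h : C.TΦc Φ v ≠ 0) : ∃ p : P.Pt, P.evalPt p (C.TΦc Φ v) ≠ 0 := by
  by_contra hall
  exact h (P.evalPt_sep _ fun p => not_not.mp (not_exists.mp hall p))
/-! ## The tier-A Witt lemma (plan C4a(ii), amendment A#9)

[PerL] ll. 476–478: "the local data (W_{i,b}, μ_{i,b}, χ_V, ψ) depend on i only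
through the sign of W_{i,b}"; ll. 341–345, 505–513: the (12)- and (34)-adapted Fock
decompositions of the same ω_{W,b} share their κ_b-part.  The bookkeeping brick is:
two orthogonal (+,−) splittings of a (1,1)-plane are isometric SIGN-TO-SIGN.  We
hand-roll the minimal hermitian-form layer (no mathlib sesquilinear bundle needed)
and prove the frame isometry on coordinates. -/

/-- A hermitian (sesquilinear, conjugate-symmetric) form on a ℂ-module — the minimal
hand-rolled layer: additive and ℂ-linear in the FIRST argument, conjugate-symmetric;
conjugate-linearity in the second argument is derived. -/
structure SesqForm (E : Type) [AddCommGroup E] [Module ℂ E] where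
  B : E → E → ℂ
  add_left : ∀ x y z : E, B (x + y) z = B x z + B y z
  smul_left : ∀ (c : ℂ) (x y : E), B (c • x) y = c * B x y
  conj_symm : ∀ x y : E, B y x = (starRingEnd ℂ) (B x y)

namespace SesqForm

variable {E : Type} [AddCommGroup E] [Module ℂ E] (F : SesqForm E)

/-- (no docstring in the 2001 source) -/
theorem add_right (x y z : E) : F.B x (y + z) = F.B x y + F.B x z := by
  rw [F.conj_symm (y + z) x, F.add_left, map_add, ← F.conj_symm, ← F.conj_symm]

/-- (no docstring in the 2001 source) -/
theorem smul_right (c : ℂ) (x y : E) :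
    F.B x (c • y) = (starRingEnd ℂ) c * F.B x y := by
  rw [F.conj_symm (c • y) x, F.smul_left, map_mul, ← F.conj_symm]

/-- (no docstring in the 2001 source) -/
theorem zero_left (y : E) : F.B 0 y = 0 := by
  have h := F.smul_left 0 0 y
  rw [zero_smul] at h
  simpa using h

end SesqForm

/-- An orthogonal (+,−) frame of a hermitian plane: a unit-positive and a
unit-negative vector, orthogonal ([PerL] l. 476–478: the two lines W_{1,b}, W_{2,b}
of a (1,1)-place, resp. W_{3,b}, W_{4,b}). -/
structure IsSplitFrame {E : Type} [AddCommGroup E] [Module ℂ E]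
    (F : SesqForm E) (ep en : E) : Prop where
  pos : F.B ep ep = 1
  neg : F.B en en = -1
  orth : F.B ep en = 0

namespace IsSplitFrame

variable {E : Type} [AddCommGroup E] [Module ℂ E] {F : SesqForm E}

/-- (no docstring in the 2001 source) -/
theorem orth' {ep en : E} (h : IsSplitFrame F ep en) : F.B en ep = 0 := by
  rw [F.conj_symm, h.orth, map_zero]

/-- The Gram expansion of a frame: B(a·e₊ + b·e₋, a′·e₊ + b′·e₋) = a·ā′ − b·b̄′. -/
theorem frame_expansion {ep en : E} (h : IsSplitFrame F ep en) (a b a' b' : ℂ) :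
    F.B (a • ep + b • en) (a' • ep + b' • en)
      = a * (starRingEnd ℂ) a' - b * (starRingEnd ℂ) b' := by
  rw [F.add_left, F.smul_left, F.smul_left, F.add_right, F.add_right,
    F.smul_right, F.smul_right, F.smul_right, F.smul_right,
    h.pos, h.neg, h.orth, h.orth']
  ring

/-- Frames are linearly independent (their Gram matrix is invertible) — the
non-degeneracy certificate. -/
theorem coeff_eq_zero {ep en : E} (h : IsSplitFrame F ep en) {a b : ℂ}
    (h0 : a • ep + b • en = 0) : a = 0 ∧ b = 0 := by
  have h1 : F.B (a • ep + b • en) ep = 0 := by rw [h0, F.zero_left]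
  have h2 : F.B (a • ep + b • en) en = 0 := by rw [h0, F.zero_left]
  rw [F.add_left, F.smul_left, F.smul_left, h.pos, h.orth'] at h1
  rw [F.add_left, F.smul_left, F.smul_left, h.orth, h.neg] at h2
  simp at h1 h2
  exact ⟨h1, h2⟩

end IsSplitFrame


-- port_pkg: scope closed for this part
end C4a
end Perl34
end HodgeCM.Prior.Perl34File
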